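import Summits.ResolutionOfSingularities.ResolutionOfSingularities.Theorems.HilbertSamuelEliminationSigmaMaxModificationsCorridor3WLadderIsoKernelTowerEmbeddingDefs
import Summits.ResolutionOfSingularities.ResolutionOfSingularities.Theorems.HilbertSamuelEliminationSigmaMaxModificationsCorridor3WLadderIsoKernelCurveShadowPoints
import Summits.ResolutionOfSingularities.ResolutionOfSingularities.Theorems.HilbertSamuelEliminationSigmaMaxModificationsCorridor3WLadderIsoKernelAlgClosed
import HarnessLib

/-!
# [OURS · L1 W4.2] KERNEL CENSUS SLICE: NO NOETHERIAN (DISCRETE RANK-ONE) VALUATION RING DOMINATES AN ISOLATED E3 POINT TOWER over an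
# algebraically-closed-residue origin; + the TRANSPORT lemmas between the canonical images and the tower's step predicates

Crux chain w42 (`SigmaMaxModifications`, stmt-ResolutionOfSingularities-18506; conjunct `SigmaMaxModificationsCorridor3`, stmt-…-19249),
line `w_ladder`, registered stub `stub_isoSepRecurrent` (K2-sep ∧ K3-sep) of skeleton v8.8. Lead res-L1-w42-lead-1 (gen 6). Helper file
`--supports stmt-ResolutionOfSingularities-19249`; kernel only (no definition, no named fact); vocabulary from `…IsoKernelTowerEmbeddingDefs`
(`towerStalkEmb`, `DominatesTower`).

WHAT IS PROVED.
* `eventually_not_satellite_of_noetherian_dominates` (subring level): a dominating chain of local subrings with principal `𝔪·B(n+1)` and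
  `𝔪 ≠ 0`, all dominated by a NOETHERIAN valuation ring `O`, has only finitely many satellite steps — the principal ideals `t_n O` increase
  (`t_n = s_n t_{n+1}`), stabilise, and `t_n O = t_{n+1} O` makes `s_n` a unit of `O`, hence of `B(n+2)`.
* TRANSPORT: `not_isSatelliteStep_of_range_form`, `isRationalStep_of_range_form` — the element forms on the canonical images
  (`towerStalkEmb`) give `¬ IsSatelliteStep` / `IsRationalStep` of card C5 (the bookkeeping every census slice needs, factored out of
  `…IsoKernelCurveShadow`).
* `false_of_isIsoPointTower_of_noetherian_dominatesTower` (+ `_over_isAlgClosed`): an isolated E3 point tower over a maximal origin with integral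
  stages, singular marked points and ALGEBRAICALLY CLOSED `κ(x_0)` is dominated by NO Noetherian valuation ring of `K(X_0)` — all steps are
  rational (p545326), the steps are eventually non-satellite, K1 (p546901) kills the free-rational tail. Census reading: at such origins every
  valuation dominating a hypothetical counterexample tower is NON-DISCRETE (value group not `ℤ`: rational rank ≥ 2 or not finitely generated) or of
  rank ≥ 2 — and by `…IsoKernelCurveShadow` not composite with a curve.

HONEST FRAMING. OURS; K1, the quadratic-transform dictionary and the rationality at algebraically closed origins are tree theorems. Nothing here is a
statement of H. Hironaka's manuscript [Hironaka2017] nor of [CossartJannsenSaito2020] / [CossartPiltant2009]. AI-written; AI review is weaker than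
expert review.
References: O. Zariski, P. Samuel, *Commutative Algebra* II, App. 5 [ZariskiSamuel1960]; S. D. Cutkosky, resolution notes §2.1–2.2 [Cutkosky2014];
V. Cossart, O. Piltant, J. Algebra 321 (2009), ch. 3 I.9 [CossartPiltant2009].
-/

noncomputable section

set_option linter.dupNamespace false

open IsLocalRing AlgebraicGeometry CategoryTheory TopologicalSpace
open Literature.AlgebraicGeometry.Resolution Literature.AlgebraicGeometry.CossartJannsenSaito2020

namespace Summit.ResolutionOfSingularities.ResolutionOfSingularities.Cruxes.SigmaMaxModifications.IdeasL1C5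

universe u

variable {T : BlowupTower.{u}} {hint : ∀ n, IsIntegral (T.X n)}

/-! ## SLICE: NO NOETHERIAN (DISCRETE RANK-ONE) VALUATION RING DOMINATES AN ISOLATED POINT TOWER over an algebraically closed residue origin -/

section NoetherianValuation

/-- **Subring level: a chain dominated by a NOETHERIAN valuation ring has finitely many satellite steps.** `B 0 ≤ B 1 ≤ ⋯` local subrings of
`L`, each dominating the previous one, `𝔪(B n)·B(n+1) = t_n·B(n+1)`, `𝔪(B n) ≠ 0`, all dominated by a valuation ring `O` of `L` which is
NOETHERIAN (a discrete valuation ring or a field): the principal ideals `t_n O` INCREASE (`t_n = s_n t_{n+1}`), hence are eventually constant, and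
`t_n O = t_{n+1} O` makes `s_n` a unit of `O`, hence of `B(n+2)` (domination) — the step is NOT satellite (`𝔪(B(n+1)) ⊆ t_n B(n+2)`).
[cite: Cutkosky2014, §2.1] [cite: ZariskiSamuel1960, App. 5] -/
theorem eventually_not_satellite_of_noetherian_dominates {L : Type u} [Field L] {B : ℕ → Subring L} [∀ n, IsLocalRing (B n)]
    (hdom : ∀ n, SubringDominates (B n) (B (n + 1)))
    (hprin : ∀ n, ∃ t ∈ maximalIdeal (B n), ∀ x ∈ maximalIdeal (B n), ∃ y : B (n + 1), (x : L) = y * t)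
    (hne : ∀ n, maximalIdeal (B n) ≠ ⊥)
    (O : ValuationSubring L) [IsNoetherianRing O] (hO : ∀ n, SubringDominates (B n) O.toSubring) :
    ∃ n₀, ∀ n, n₀ ≤ n → ∃ t ∈ maximalIdeal (B n), ∀ x ∈ maximalIdeal (B (n + 1)), ∃ y : B (n + 2), (x : L) = y * t := by
  classical
  choose t ht hgen using hprin
  have htincl : ∀ n, Subring.inclusion (hdom n).1 (t n) ∈ maximalIdeal (B (n + 1)) :=
    fun n => inclusion_mem_maximalIdeal (hdom n) (ht n)
  have hs' : ∀ n, ∃ s : B (n + 2), (t n : L) = s * t (n + 1) := fun n => hgen (n + 1) _ (htincl n)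
  choose s hs using hs'
  -- `t n ≠ 0`
  have ht0 : ∀ n, (t n : L) ≠ 0 := by
    intro n h0
    apply hne n
    rw [eq_bot_iff]
    intro x hx
    obtain ⟨y, hy⟩ := hgen n x hx
    rw [h0, mul_zero] at hy
    exact (Submodule.mem_bot _).mpr (Subtype.ext hy)
  -- the increasing chain of principal ideals `t n O`
  have hBO : ∀ n, B n ≤ O.toSubring := fun n => (hO n).1
  let tO : ∀ n, O := fun n => ⟨t n, hBO n (t n).2⟩
  let sO : ∀ n, O := fun n => ⟨s n, hBO (n + 2) (s n).2⟩
  have htO : ∀ n, tO n = sO n * tO (n + 1) := fun n => Subtype.ext (hs n)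
  let J : ℕ →o Ideal O :=
    ⟨fun n => Ideal.span {tO n}, monotone_nat_of_le_succ fun n => by
      rw [Ideal.span_singleton_le_iff_mem, htO n]
      exact Ideal.mul_mem_left _ _ (Ideal.mem_span_singleton_self _)⟩
  obtain ⟨n₀, hn₀⟩ := monotone_stabilizes_iff_noetherian.mpr (inferInstance : IsNoetherianRing O) J
  refine ⟨n₀, fun n hn => ⟨t n, ht n, fun x hx => ?_⟩⟩
  -- `t (n+1) ∈ t n O`, so `s n` is a unit of `O`, hence of `B (n+2)`
  have hJ : Ideal.span {tO (n + 1)} = Ideal.span {tO n} := by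
    have h1 := hn₀ (n + 1) (Nat.le_succ_of_le hn)
    have h2 := hn₀ n hn
    change Ideal.span {tO n₀} = Ideal.span {tO (n + 1)} at h1
    change Ideal.span {tO n₀} = Ideal.span {tO n} at h2
    rw [← h1, ← h2]
  obtain ⟨u, hu⟩ : ∃ u : O, u * tO n = tO (n + 1) := by
    have : tO (n + 1) ∈ Ideal.span {tO n} := by rw [← hJ]; exact Ideal.mem_span_singleton_self _
    exact Ideal.mem_span_singleton'.mp this
  have hut : (u : L) * t n = t (n + 1) := by
    have h := congrArg (fun z : O => (z : L)) hu
    simpa using h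
  have hsu : (u : L) * s n = 1 := by
    have h' : ((u : L) * s n) * t (n + 1) = 1 * t (n + 1) := by
      rw [one_mul, mul_assoc, ← hs n, hut]
    exact mul_right_cancel₀ (ht0 (n + 1)) h'
  have hsinvO : (s n : L)⁻¹ ∈ O := by
    rw [inv_eq_of_mul_eq_one_left hsu]; exact u.2
  have hsinv : (s n : L)⁻¹ ∈ B (n + 2) := (hO (n + 2)).2 _ (s n).2 hsinvO
  have hs0 : (s n : L) ≠ 0 := right_ne_zero_of_mul_eq_one hsu
  obtain ⟨y, hy⟩ := hgen (n + 1) x hx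
  refine ⟨y * ⟨(s n : L)⁻¹, hsinv⟩, ?_⟩
  rw [hy, Subring.coe_mul, mul_assoc]
  congr 1
  change (t (n + 1) : L) = (s n : L)⁻¹ * t n
  rw [hs n, ← mul_assoc, inv_mul_cancel₀ hs0, one_mul]


/-! ### Transport between the canonical images and the tower's step predicates -/

variable {pt : ∀ n, T.X n}

open Summit.ResolutionOfSingularities.ResolutionOfSingularities.Cruxes.SigmaMaxModifications.IdeasL1Idea2R4 (IsIsoPointTower)
open Summit.ResolutionOfSingularities.ResolutionOfSingularities.Theorems.CampaignW42 (IsMaximalOrigin)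
open Summit.ResolutionOfSingularities.ResolutionOfSingularities.Theorems.SigmaMaxModificationsCorridor3 (IsoTailsHS.isoFreeRationalTailsImpossible_holds)

/-- **TRANSPORT (satellite).** If, read through the canonical embeddings, `𝔪(B(n+1)) ⊆ t · B(n+2)` for some `t ∈ 𝔪(B n)` (`B m` = image of
`𝒪_{X_m, pt m}`), then step `n` of the tower is NOT a satellite step (`𝔪_{x_n}𝒪_{x_{n+2}} = 𝔪_{x_{n+1}}𝒪_{x_{n+2}}`). [cite: ZariskiSamuel1960, App. 5] -/
theorem not_isSatelliteStep_of_range_form (hpt : ∀ n, (T.π n).base (pt (n + 1)) = pt n)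
    [hB : ∀ n (y : T.X n), IsLocalRing (towerStalkEmb T hint n y).range] (n : ℕ)
    (h : ∃ t ∈ maximalIdeal (towerStalkEmb T hint n (pt n)).range,
      ∀ x ∈ maximalIdeal (towerStalkEmb T hint (n + 1) (pt (n + 1))).range,
        ∃ y : (towerStalkEmb T hint (n + 2) (pt (n + 2))).range, (x : (T.X 0).functionField) = y * t) :
    ¬ IsSatelliteStep T pt n := by
  haveI := hint
  haveI := fun n => T.ln n
  set Θ := towerStalkEmb T hint with hΘ
  have hmax : ∀ n (y : T.X n) (a : (T.X n).presheaf.stalk y),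
      a ∈ maximalIdeal _ ↔ (⟨Θ n y a, ⟨a, rfl⟩⟩ : (Θ n y).range) ∈ maximalIdeal (Θ n y).range :=
    fun n y a => mem_maximalIdeal_iff_range (Θ n y) (towerStalkEmb_injective T hint n y) a
  obtain ⟨t, ht, hgen⟩ := h
  intro hsat
  apply hsat
  set y₁ := (T.π (n + 1)).base (pt (n + 2)) with hy₁
  set y₀ := (T.π n).base y₁ with hy₀
  set sm₁ := ((T.π (n + 1)).stalkMap (pt (n + 2))).hom with hsm₁
  set sm₀ := ((T.π n).stalkMap y₁).hom with hsm₀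
  have hB1 : (Θ (n + 1) y₁).range = (Θ (n + 1) (pt (n + 1))).range := by rw [hy₁, hpt (n + 1)]
  have hB0 : (Θ n y₀).range = (Θ n (pt n)).range := by rw [hy₀, hy₁, hpt (n + 1), hpt n]
  have hcompst : ((T.π (n + 1) ≫ T.π n).stalkMap (pt (n + 2))).hom = sm₁.comp sm₀ := by
    rw [hsm₁, hsm₀, Scheme.Hom.stalkMap_comp]
    rfl
  have hLHS : Ideal.map ((T.π (n + 1) ≫ T.π n).stalkMap (pt (n + 2))).hom (maximalIdeal _) =
      ((maximalIdeal ((T.X n).presheaf.stalk y₀)).map sm₀).map sm₁ := by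
    rw [Ideal.map_map, ← hcompst]
    exact rfl
  rw [hLHS]
  apply le_antisymm
  · exact Ideal.map_mono (IsLocalRing.map_maximalIdeal_le sm₀)
  · rw [Ideal.map_le_iff_le_comap]
    intro g hg
    rw [Ideal.mem_comap]
    have hgB : (⟨Θ (n + 1) y₁ g, by rw [← hB1]; exact ⟨g, rfl⟩⟩ : (Θ (n + 1) (pt (n + 1))).range) ∈ maximalIdeal _ := by
      rw [← mem_maximalIdeal_subring_congr hB1 ⟨g, rfl⟩]
      exact (hmax (n + 1) y₁ g).mp hg
    obtain ⟨yv, hyv⟩ := hgen _ hgB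
    change Θ (n + 1) y₁ g = (yv : (T.X 0).functionField) * t at hyv
    obtain ⟨tt, htt⟩ : (t : (T.X 0).functionField) ∈ (Θ n y₀).range := by rw [hB0]; exact t.2
    have httm : tt ∈ maximalIdeal _ := by
      rw [hmax n y₀ tt, mem_maximalIdeal_subring_congr hB0 ⟨tt, rfl⟩ (by rw [htt]; exact t.2)]
      have : (⟨Θ n y₀ tt, by rw [htt]; exact t.2⟩ : (Θ n (pt n)).range) = t := Subtype.ext htt
      rw [this]; exact ht
    obtain ⟨yt, hyt⟩ : (yv : (T.X 0).functionField) ∈ (Θ (n + 2) (pt (n + 2))).range := yv.2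
    have h1 : Θ (n + 2) (pt (n + 2)) (sm₁ g) = Θ (n + 1) y₁ g :=
      RingHom.congr_fun (towerStalkEmb_comp_stalkMap T hint (n + 1) (pt (n + 2))) g
    have h2a : Θ (n + 2) (pt (n + 2)) (sm₁ (sm₀ tt)) = Θ (n + 1) y₁ (sm₀ tt) :=
      RingHom.congr_fun (towerStalkEmb_comp_stalkMap T hint (n + 1) (pt (n + 2))) (sm₀ tt)
    have h2b : Θ (n + 1) y₁ (sm₀ tt) = Θ n y₀ tt := RingHom.congr_fun (towerStalkEmb_comp_stalkMap T hint n y₁) tt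
    have hkey : sm₁ g = yt * sm₁ (sm₀ tt) :=
      towerStalkEmb_injective T hint (n + 2) (pt (n + 2)) (by rw [map_mul, h1, h2a, h2b, hyt, htt, hyv])
    rw [hkey]
    exact Ideal.mul_mem_left _ _ (Ideal.mem_map_of_mem _ (Ideal.mem_map_of_mem _ httm))

/-- **TRANSPORT (rational).** If, read through the canonical embeddings, every element of `B(n+1)` is congruent mod `𝔪(B(n+1))` to an element of
`B n`, then step `n` is RATIONAL (`κ(x_n) → κ(x_{n+1})` onto). [folklore] -/
theorem isRationalStep_of_range_form (hpt : ∀ n, (T.π n).base (pt (n + 1)) = pt n)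
    [hB : ∀ n (y : T.X n), IsLocalRing (towerStalkEmb T hint n y).range] (n : ℕ)
    (hle : (towerStalkEmb T hint n (pt n)).range ≤ (towerStalkEmb T hint (n + 1) (pt (n + 1))).range)
    (h : ∀ y : (towerStalkEmb T hint (n + 1) (pt (n + 1))).range, ∃ x : (towerStalkEmb T hint n (pt n)).range,
      y - Subring.inclusion hle x ∈ maximalIdeal _) :
    IsRationalStep T pt n := by
  haveI := hint
  haveI := fun n => T.ln n
  set Θ := towerStalkEmb T hint with hΘ
  have hmax : ∀ n (y : T.X n) (a : (T.X n).presheaf.stalk y),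
      a ∈ maximalIdeal _ ↔ (⟨Θ n y a, ⟨a, rfl⟩⟩ : (Θ n y).range) ∈ maximalIdeal (Θ n y).range :=
    fun n y a => mem_maximalIdeal_iff_range (Θ n y) (towerStalkEmb_injective T hint n y) a
  have hB0' : (Θ n ((T.π n).base (pt (n + 1)))).range = (Θ n (pt n)).range := by rw [hpt n]
  change Function.Surjective (IsLocalRing.ResidueField.map ((T.π n).stalkMap (pt (n + 1))).hom)
  intro r
  obtain ⟨yt, rfl⟩ := IsLocalRing.residue_surjective r
  set yB : (Θ (n + 1) (pt (n + 1))).range := ⟨Θ (n + 1) (pt (n + 1)) yt, ⟨yt, rfl⟩⟩ with hyB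
  obtain ⟨x, hx⟩ := h yB
  obtain ⟨xt, hxt⟩ : (x : (T.X 0).functionField) ∈ (Θ n ((T.π n).base (pt (n + 1)))).range := by rw [hB0']; exact x.2
  refine ⟨IsLocalRing.residue _ xt, ?_⟩
  rw [IsLocalRing.ResidueField.map_residue, ← sub_eq_zero, ← map_sub, IsLocalRing.residue_eq_zero_iff, hmax (n + 1) (pt (n + 1))]
  have hΘx : Θ (n + 1) (pt (n + 1)) (((T.π n).stalkMap (pt (n + 1))).hom xt) = x := by
    rw [← hxt]; exact RingHom.congr_fun (towerStalkEmb_comp_stalkMap T hint n (pt (n + 1))) xt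
  have hel : (⟨Θ (n + 1) (pt (n + 1)) (((T.π n).stalkMap (pt (n + 1))).hom xt - yt), ⟨_, rfl⟩⟩ : (Θ (n + 1) (pt (n + 1))).range) =
      -(yB - Subring.inclusion hle x) := by
    apply Subtype.ext
    change Θ (n + 1) (pt (n + 1)) (((T.π n).stalkMap (pt (n + 1))).hom xt - yt) =
      -((Θ (n + 1) (pt (n + 1)) yt) - (x : (T.X 0).functionField))
    rw [map_sub, hΘx]; ring
  rw [hel]
  exact neg_mem hx

/-- **NO NOETHERIAN VALUATION RING DOMINATES AN ISOLATED E3 POINT TOWER OVER AN ALGEBRAICALLY-CLOSED-RESIDUE ORIGIN** (kernel census slice: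
the discrete rank-one class is EMPTY there). An isolated E3 point tower (`IsIsoPointTower 3 ν T pt`) over a maximal origin with integral stages, singular
marked points and `κ(x_0)` algebraically closed cannot be dominated (`DominatesTower`) by a NOETHERIAN valuation ring of `K(X_0)` (a DVR: divisorial,
arc-like or otherwise): all steps are rational (`forall_isRationalStep_of_isAlgClosed_origin`, p545326), the principal ideals `t_n O` stabilise so the
steps are eventually non-satellite (`eventually_not_satellite_of_noetherian_dominates`), and K1 (p546901) kills the free-rational tail.
[cite: CossartPiltant2009, ch. 3 I.9] [cite: ZariskiSamuel1960, App. 5] [cite: Cutkosky2014, §2.2] -/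
theorem false_of_isIsoPointTower_of_noetherian_dominatesTower {p : ℕ} {ν : ℕ → ℕ}
    (hsing : ∀ n, ¬ IsRegularLocalRing ((T.X n).presheaf.stalk (pt n)))
    (hO : IsMaximalOrigin p 3 ν (T.X 0) (pt 0)) (hT : IsIsoPointTower 3 ν T pt)
    (halg : IsAlgClosed (ResidueField ((T.X 0).presheaf.stalk (pt 0))))
    (O : ValuationSubring (T.X 0).functionField) [IsNoetherianRing O] (hdomT : DominatesTower T hint pt O) : False := by
  haveI := hint
  haveI := fun n => T.ln n
  set Θ := towerStalkEmb T hint with hΘ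
  haveI hB : ∀ n (y : T.X n), IsLocalRing (Θ n y).range := fun n y => isLocalRing_of_range_eq (Θ n y) _ rfl
  have hdom : ∀ n, SubringDominates (Θ n (pt n)).range (Θ (n + 1) (pt (n + 1))).range :=
    subringDominates_range_succ hT.2.1 (fun n => Θ n (pt n)) (fun n => towerStalkEmb_injective T hint n _)
      (towerStalkEmb_comp_stalkMap_pt T hint hT.2.1)
  obtain ⟨O', -, hQT⟩ := exists_dominatesTower T hint hT.1 hT.2.1 hT.2.2.1
  have hprin : ∀ n, ∃ t ∈ maximalIdeal (Θ n (pt n)).range, ∀ x ∈ maximalIdeal (Θ n (pt n)).range,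
      ∃ y : (Θ (n + 1) (pt (n + 1))).range, (x : (T.X 0).functionField) = y * t := by
    intro n
    obtain ⟨_, hLB⟩ := hQT n
    obtain ⟨u₀, hu₀, hgen⟩ := hLB.exists_span_singleton
    exact ⟨u₀, hu₀, fun x hx => by obtain ⟨y, hy, hxy⟩ := hgen x hx; exact ⟨⟨y, hy⟩, hxy⟩⟩
  have hne : ∀ n, maximalIdeal (Θ n (pt n)).range ≠ ⊥ := by
    intro n h
    apply hsing n
    have hmax : ∀ a : (T.X n).presheaf.stalk (pt n), a ∈ maximalIdeal _ ↔ (⟨Θ n (pt n) a, ⟨a, rfl⟩⟩ : (Θ n (pt n)).range) ∈ maximalIdeal _ :=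
      fun a => mem_maximalIdeal_iff_range (Θ n (pt n)) (towerStalkEmb_injective T hint n _) a
    have hbot : maximalIdeal ((T.X n).presheaf.stalk (pt n)) = ⊥ := by
      rw [eq_bot_iff]; intro a ha
      have := (hmax a).mp ha
      rw [h, Ideal.mem_bot] at this
      exact (Ideal.mem_bot).mpr (towerStalkEmb_injective T hint n _ (by rw [map_zero]; exact congrArg Subtype.val this))
    exact isRegularLocalRing_of_isField ((IsLocalRing.isField_iff_maximalIdeal_eq).mpr hbot)
  obtain ⟨n₀, hn₀⟩ := eventually_not_satellite_of_noetherian_dominates hdom hprin hne O hdomT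
  exact IsoTailsHS.isoFreeRationalTailsImpossible_holds p ν T pt hO hT
    ⟨n₀, fun n hn => ⟨forall_isRationalStep_of_isAlgClosed_origin hT halg n, not_isSatelliteStep_of_range_form hT.2.1 n (hn₀ n hn)⟩⟩

/-- … ground-field form: origin stage of finite type over an ALGEBRAICALLY CLOSED field. [cite: CossartPiltant2009, ch. 3 I.9] -/
theorem false_of_isIsoPointTower_of_noetherian_dominatesTower_over_isAlgClosed {p : ℕ} {ν : ℕ → ℕ}
    (hsing : ∀ n, ¬ IsRegularLocalRing ((T.X n).presheaf.stalk (pt n)))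
    {k : Type u} [Field k] [IsAlgClosed k] (f : T.X 0 ⟶ Spec (.of k)) [LocallyOfFiniteType f]
    (hO : IsMaximalOrigin p 3 ν (T.X 0) (pt 0)) (hT : IsIsoPointTower 3 ν T pt)
    (O : ValuationSubring (T.X 0).functionField) [IsNoetherianRing O] (hdomT : DominatesTower T hint pt O) : False :=
  false_of_isIsoPointTower_of_noetherian_dominatesTower hsing hO hT
    (IsAlgClosed.of_ringEquiv k _ (residueFieldIsoBase f (pt 0) (hT.2.2.1 0)).commRingCatIsoToRingEquiv.symm) O hdomT

end NoetherianValuation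
end Summit.ResolutionOfSingularities.ResolutionOfSingularities.Cruxes.SigmaMaxModifications.IdeasL1C5

end
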